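import Mathlib
import HarnessLib
import Summits.Ventures.LatticeQCDFlow.Scaling.TorusPlaquetteCoverOrder

/-!
# LatticeQCDFlow / Scaling — the counting constant `d/4` of the volume law is attained:
# parity-staggered generation orders of the links of `(ℤ/L)^d`, `d = 2, 3, 4`, `L` even, close
# plaquettes at exactly `d·#sites/4` links

HONEST FRAMING: exact (Metropolis-corrected) sampling algorithms for lattice gauge theory;
figures of merit are autocorrelation/cost numbers at stated couplings and volumes; no
continuum-physics claim.

Venture `LatticeQCDFlow` (cell pub-lqcd), topic `Scaling`, FANOUT row 30 (lean-1, GEN-23) — OUR WORK on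
THEORY-2.md §4 row C5 (autoregressive context), the COUNTING step of the volume law.  By
`Scaling/TorusPlaquetteCoverOrder`, an EXACT PLAQUETTE COVER `C` of `(ℤ/L)^d` (every plaquette has
exactly one of its four links in `C`) yields a generation order of all links whose plaquette last links
are exactly the `d·#sites/4` links of `C` — the lower bound `#T ≥ #plaquettes/(2(d−1))` of
`Scaling/TorusPlaquetteLastLinks.exists_lastLinks_all` attained, so the per-link count `d·#sites/4` of
the volume laws `Scaling/AutoregressiveGaugeKLExtensiveAllPlanes…` cannot be raised by counting alone.
Here: exact covers EXIST in the lattice dimensions `d = 2, 3, 4` for every even `L`, by parities of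
the base site — `d = 2`: the `1`-links at odd `x₀`; `d = 3`: the `μ`-links at `x_{μ−1}` odd and
`x_{μ+1}` even (indices mod 3); `d = 4`: the `0`-links at `x₁ ≡ x₂ ≡ x₃`, the `1`-links at
`x₀ ≡ x₂ ≢ x₃`, the `2`-links at `x₀ ≡ x₃ ≢ x₁`, the `3`-links at `x₀ ≡ x₁ ≢ x₂` (found by exhaustive
search; verified here by `decide` on the parity classes).  For the record, NOT formalised: no
parity-periodic exact cover exists in `d = 5, 6` (exhaustive search on `(ℤ/2)^d`); whether `d/4` is
attained for `d ≥ 5` with longer periods is left open.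

## What is proved (all [ours] unless marked)

* §1 `site_parity_shift` — the coordinatewise reduction `(ℤ/L)^d → (ℤ/2)^d` (`2 ∣ L`) turns a unit shift
  into adding `Pi.single i 1` [folklore]; **`exists_plaquetteCover_of_pattern`** — a direction/parity
  predicate selecting exactly one of the four links of every parity class of plaquettes defines an exact
  cover of `(ℤ/L)^d`, `2 ∣ L`; **`exists_plaquetteCover_two/three/four`** — the three covers.
* §2 `two_le_of_even`; **`exists_sharp_order_two/three/four`** — for `d = 2, 3, 4` and `L` even there
  are a duplicate-free list `l` of all links and a set `C` with `4·#C = d·#sites` and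
  `#C·2(d−1) = #plaquettes` containing the last link (in `l`) of every plaquette.

Pure lattice combinatorics; no measure theory.  No `def`, no `sorry`, nothing cited as a fact.
-/

namespace Summit.Ventures.LatticeQCDFlow.Theory2.Autoregressive

open Literature.MathematicalPhysics.QuantumFieldTheory

/-! ## §1 Parity: exact covers of `(ℤ/L)^d`, `L` even, `d = 2, 3, 4` -/

/-- The coordinatewise reduction `(ℤ/L)^d → (ℤ/2)^d` (`2 ∣ L`) turns the unit shift `x ↦ x + e_i` into
adding `Pi.single i 1`. [folklore] -/
theorem site_parity_shift {d L : ℕ} (h2 : 2 ∣ L) (x : Site d L) (i : Fin d) :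
    (fun k => ZMod.castHom h2 (ZMod 2) ((x.shift i) k)) =
      (fun k => ZMod.castHom h2 (ZMod 2) (x k)) + Pi.single i 1 := by
  ext k
  simp only [Site.shift, Pi.add_apply, map_add]
  by_cases hk : k = i
  · subst hk; rw [Pi.single_eq_same, Pi.single_eq_same, map_one]
  · rw [Pi.single_eq_of_ne hk, Pi.single_eq_of_ne hk, map_zero]

/-- **Pattern ⇒ cover.**  `P μ w` decides from the direction `μ` and the parity vector `w ∈ (ℤ/2)^d` of
the base site whether a link is in `C`.  If for every parity vector `w` and every plane `i < j` EXACTLY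
ONE of `P i w`, `P j (w + e_i)`, `P i (w + e_j)`, `P j w` holds (the parities of the four links
`(x,i), (x+e_i,j), (x+e_j,i), (x,j)` of the plaquette `(x; i, j)`), then
`C = {(x, μ) : P μ (x mod 2)}` is an exact plaquette cover of `(ℤ/L)^d` for every `L` with `2 ∣ L`. [ours] -/
theorem exists_plaquetteCover_of_pattern {d L : ℕ} [NeZero L] (h2 : 2 ∣ L)
    (P : Fin d → (Fin d → ZMod 2) → Prop) [∀ μ w, Decidable (P μ w)]
    (hP : ∀ (w : Fin d → ZMod 2) (i j : Fin d), i < j →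
      (P i w ∧ ¬ P j (w + Pi.single i 1) ∧ ¬ P i (w + Pi.single j 1) ∧ ¬ P j w) ∨
      (¬ P i w ∧ P j (w + Pi.single i 1) ∧ ¬ P i (w + Pi.single j 1) ∧ ¬ P j w) ∨
      (¬ P i w ∧ ¬ P j (w + Pi.single i 1) ∧ P i (w + Pi.single j 1) ∧ ¬ P j w) ∨
      (¬ P i w ∧ ¬ P j (w + Pi.single i 1) ∧ ¬ P i (w + Pi.single j 1) ∧ P j w)) :
    ∃ C : Finset (Edge d L), ∀ p : Plaquette d L, ∃ e ∈ ({(p.1, p.2.1.1), (p.1.shift p.2.1.1, p.2.1.2),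
        (p.1.shift p.2.1.2, p.2.1.1), (p.1, p.2.1.2)} : Finset (Edge d L)),
      e ∈ C ∧ ∀ e' ∈ ({(p.1, p.2.1.1), (p.1.shift p.2.1.1, p.2.1.2),
        (p.1.shift p.2.1.2, p.2.1.1), (p.1, p.2.1.2)} : Finset (Edge d L)), e' ≠ e → e' ∉ C := by
  classical
  set par : Site d L → (Fin d → ZMod 2) := fun x k => ZMod.castHom h2 (ZMod 2) (x k) with hpar
  have hps : ∀ (x : Site d L) (i : Fin d), par (x.shift i) = par x + Pi.single i 1 :=
    fun x i => site_parity_shift h2 x i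
  refine ⟨Finset.univ.filter (fun e : Edge d L => P e.2 (par e.1)), fun p => ?_⟩
  obtain ⟨x, ⟨⟨i, j⟩, hij⟩⟩ := p
  have hmemC : ∀ e : Edge d L, e ∈ Finset.univ.filter (fun e : Edge d L => P e.2 (par e.1)) ↔ P e.2 (par e.1) :=
    fun e => by simp
  simp only [Finset.mem_insert, Finset.mem_singleton, hmemC]
  have e1 : P (x, i).2 (par (x, i).1) ↔ P i (par x) := Iff.rfl
  have e2 : P (x.shift i, j).2 (par (x.shift i, j).1) ↔ P j (par x + Pi.single i 1) := by
    show P j (par (x.shift i)) ↔ _; rw [hps]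
  have e3 : P (x.shift j, i).2 (par (x.shift j, i).1) ↔ P i (par x + Pi.single j 1) := by
    show P i (par (x.shift j)) ↔ _; rw [hps]
  have e4 : P (x, j).2 (par (x, j).1) ↔ P j (par x) := Iff.rfl
  rcases hP (par x) i j hij with ⟨a1, a2, a3, a4⟩ | ⟨a1, a2, a3, a4⟩ | ⟨a1, a2, a3, a4⟩ | ⟨a1, a2, a3, a4⟩
  · refine ⟨(x, i), Or.inl rfl, e1.2 a1, fun e' he' hne => ?_⟩
    rcases he' with rfl | rfl | rfl | rfl
    · exact absurd rfl hne
    · exact fun h => a2 (e2.1 h)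
    · exact fun h => a3 (e3.1 h)
    · exact fun h => a4 (e4.1 h)
  · refine ⟨(x.shift i, j), Or.inr (Or.inl rfl), e2.2 a2, fun e' he' hne => ?_⟩
    rcases he' with rfl | rfl | rfl | rfl
    · exact fun h => a1 (e1.1 h)
    · exact absurd rfl hne
    · exact fun h => a3 (e3.1 h)
    · exact fun h => a4 (e4.1 h)
  · refine ⟨(x.shift j, i), Or.inr (Or.inr (Or.inl rfl)), e3.2 a3, fun e' he' hne => ?_⟩
    rcases he' with rfl | rfl | rfl | rfl
    · exact fun h => a1 (e1.1 h)
    · exact fun h => a2 (e2.1 h)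
    · exact absurd rfl hne
    · exact fun h => a4 (e4.1 h)
  · refine ⟨(x, j), Or.inr (Or.inr (Or.inr rfl)), e4.2 a4, fun e' he' hne => ?_⟩
    rcases he' with rfl | rfl | rfl | rfl
    · exact fun h => a1 (e1.1 h)
    · exact fun h => a2 (e2.1 h)
    · exact fun h => a3 (e3.1 h)
    · exact absurd rfl hne

/-- **Exact cover in two dimensions** (`2 ∣ L`): the `1`-links `((x₀, x₁), 1)` with `x₀` odd — every
plaquette `(x; 0, 1)` contains the two `1`-links at `x` and `x + e₀`, of opposite `x₀`-parity. [ours] -/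
theorem exists_plaquetteCover_two {L : ℕ} [NeZero L] (h2 : 2 ∣ L) :
    ∃ C : Finset (Edge 2 L), ∀ p : Plaquette 2 L, ∃ e ∈ ({(p.1, p.2.1.1), (p.1.shift p.2.1.1, p.2.1.2),
        (p.1.shift p.2.1.2, p.2.1.1), (p.1, p.2.1.2)} : Finset (Edge 2 L)),
      e ∈ C ∧ ∀ e' ∈ ({(p.1, p.2.1.1), (p.1.shift p.2.1.1, p.2.1.2),
        (p.1.shift p.2.1.2, p.2.1.1), (p.1, p.2.1.2)} : Finset (Edge 2 L)), e' ≠ e → e' ∉ C := by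
  refine exists_plaquetteCover_of_pattern h2 (fun μ w => μ = 1 ∧ w 0 = 1) ?_
  intro w i j hij
  have hw : w = ![w 0, w 1] := by ext k; fin_cases k <;> rfl
  rw [hw]
  generalize w 0 = a
  generalize w 1 = b
  fin_cases i <;> fin_cases j <;> first | exact absurd hij (by decide) | (revert a b; decide)

/-- **Exact cover in three dimensions** (`2 ∣ L`): the `μ`-links at sites with `x_{μ−1}` odd and
`x_{μ+1}` even (indices mod 3). [ours] -/
theorem exists_plaquetteCover_three {L : ℕ} [NeZero L] (h2 : 2 ∣ L) :
    ∃ C : Finset (Edge 3 L), ∀ p : Plaquette 3 L, ∃ e ∈ ({(p.1, p.2.1.1), (p.1.shift p.2.1.1, p.2.1.2),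
        (p.1.shift p.2.1.2, p.2.1.1), (p.1, p.2.1.2)} : Finset (Edge 3 L)),
      e ∈ C ∧ ∀ e' ∈ ({(p.1, p.2.1.1), (p.1.shift p.2.1.1, p.2.1.2),
        (p.1.shift p.2.1.2, p.2.1.1), (p.1, p.2.1.2)} : Finset (Edge 3 L)), e' ≠ e → e' ∉ C := by
  refine exists_plaquetteCover_of_pattern h2
    (fun μ w => w (![2, 0, 1] μ) = 1 ∧ w (![1, 2, 0] μ) = 0) ?_
  intro w i j hij
  have hw : w = ![w 0, w 1, w 2] := by ext k; fin_cases k <;> rfl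
  rw [hw]
  generalize w 0 = a
  generalize w 1 = b
  generalize w 2 = c
  fin_cases i <;> fin_cases j <;> first | exact absurd hij (by decide) | (revert a b c; decide)

/-- **Exact cover in four dimensions** (`2 ∣ L`), by parities of the base site: the `0`-links at
`x₁ ≡ x₂ ≡ x₃`, the `1`-links at `x₀ ≡ x₂ ≢ x₃`, the `2`-links at `x₀ ≡ x₃ ≢ x₁`, the `3`-links at
`x₀ ≡ x₁ ≢ x₂` (found by exhaustive search; one of the eight parity solutions, written as two affine
parity equations per direction). [ours] -/
theorem exists_plaquetteCover_four {L : ℕ} [NeZero L] (h2 : 2 ∣ L) :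
    ∃ C : Finset (Edge 4 L), ∀ p : Plaquette 4 L, ∃ e ∈ ({(p.1, p.2.1.1), (p.1.shift p.2.1.1, p.2.1.2),
        (p.1.shift p.2.1.2, p.2.1.1), (p.1, p.2.1.2)} : Finset (Edge 4 L)),
      e ∈ C ∧ ∀ e' ∈ ({(p.1, p.2.1.1), (p.1.shift p.2.1.1, p.2.1.2),
        (p.1.shift p.2.1.2, p.2.1.1), (p.1, p.2.1.2)} : Finset (Edge 4 L)), e' ≠ e → e' ∉ C := by
  refine exists_plaquetteCover_of_pattern h2
    (fun μ w => w (![2, 2, 1, 1] μ) + w (![3, 3, 3, 2] μ) = ![0, 1, 1, 1] μ ∧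
      w (![1, 0, 0, 0] μ) + w (![3, 3, 3, 2] μ) = ![0, 1, 0, 1] μ) ?_
  intro w i j hij
  have hw : w = ![w 0, w 1, w 2, w 3] := by ext k; fin_cases k <;> rfl
  rw [hw]
  generalize w 0 = a
  generalize w 1 = b
  generalize w 2 = c
  generalize w 3 = e
  fin_cases i <;> fin_cases j <;> first | exact absurd hij (by decide) | (revert a b c e; decide)

/-! ## §2 The sharp orders in `d = 2, 3, 4` -/

/-- `L` even and nonzero forces `L ≥ 2`. [folklore] -/
theorem two_le_of_even {L : ℕ} [NeZero L] (hL : Even L) : 2 ≤ L := by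
  obtain ⟨k, hk⟩ := hL
  have := NeZero.ne L
  omega

/-- **The counting constant `d/4` is attained in two dimensions**: for even `L` there are a
duplicate-free list `l` of all links of `(ℤ/L)²` and a set `C` of `#sites/2` links (`4·#C = 2·#sites`,
`#C·2 = #plaquettes`) containing the last link (in `l`) of every plaquette. [ours] -/
theorem exists_sharp_order_two {L : ℕ} [NeZero L] (hL : Even L) :
    ∃ (l : List (Edge 2 L)) (C : Finset (Edge 2 L)), l.Nodup ∧ (∀ e : Edge 2 L, e ∈ l) ∧
      4 * C.card = 2 * Fintype.card (Site 2 L) ∧ C.card * (2 * (2 - 1)) = Fintype.card (Plaquette 2 L) ∧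
      ∀ p : Plaquette 2 L, ∃ e ∈ ({(p.1, p.2.1.1), (p.1.shift p.2.1.1, p.2.1.2),
          (p.1.shift p.2.1.2, p.2.1.1), (p.1, p.2.1.2)} : Finset (Edge 2 L)),
        e ∈ C ∧ ∀ e' ∈ ({(p.1, p.2.1.1), (p.1.shift p.2.1.1, p.2.1.2),
          (p.1.shift p.2.1.2, p.2.1.1), (p.1, p.2.1.2)} : Finset (Edge 2 L)), e' ≠ e → l.idxOf e' < l.idxOf e := by
  obtain ⟨C, hC⟩ := exists_plaquetteCover_two (L := L) (even_iff_two_dvd.1 hL)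
  obtain ⟨l, h⟩ := exists_sharp_order_of_cover le_rfl (two_le_of_even hL) C hC
  exact ⟨l, C, h⟩

/-- **The counting constant `d/4` is attained in three dimensions**: for even `L` there are a
duplicate-free list `l` of all links of `(ℤ/L)³` and a set `C` of `3·#sites/4` links (`4·#C = 3·#sites`,
`#C·4 = #plaquettes`) containing the last link (in `l`) of every plaquette. [ours] -/
theorem exists_sharp_order_three {L : ℕ} [NeZero L] (hL : Even L) :
    ∃ (l : List (Edge 3 L)) (C : Finset (Edge 3 L)), l.Nodup ∧ (∀ e : Edge 3 L, e ∈ l) ∧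
      4 * C.card = 3 * Fintype.card (Site 3 L) ∧ C.card * (2 * (3 - 1)) = Fintype.card (Plaquette 3 L) ∧
      ∀ p : Plaquette 3 L, ∃ e ∈ ({(p.1, p.2.1.1), (p.1.shift p.2.1.1, p.2.1.2),
          (p.1.shift p.2.1.2, p.2.1.1), (p.1, p.2.1.2)} : Finset (Edge 3 L)),
        e ∈ C ∧ ∀ e' ∈ ({(p.1, p.2.1.1), (p.1.shift p.2.1.1, p.2.1.2),
          (p.1.shift p.2.1.2, p.2.1.1), (p.1, p.2.1.2)} : Finset (Edge 3 L)), e' ≠ e → l.idxOf e' < l.idxOf e := by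
  obtain ⟨C, hC⟩ := exists_plaquetteCover_three (L := L) (even_iff_two_dvd.1 hL)
  obtain ⟨l, h⟩ := exists_sharp_order_of_cover (by norm_num) (two_le_of_even hL) C hC
  exact ⟨l, C, h⟩

/-- **The counting constant `d/4` is attained in four dimensions**: for even `L` there are a
duplicate-free list `l` of all links of `(ℤ/L)⁴` and a set `C` of `#sites = L⁴` links (`4·#C = 4·#sites`,
`#C·6 = #plaquettes`) containing the last link (in `l`) of every plaquette — so the volume-law count
`d·#sites/4` of `Scaling/AutoregressiveGaugeKLExtensiveAllPlanes…` cannot be raised by counting alone. [ours] -/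
theorem exists_sharp_order_four {L : ℕ} [NeZero L] (hL : Even L) :
    ∃ (l : List (Edge 4 L)) (C : Finset (Edge 4 L)), l.Nodup ∧ (∀ e : Edge 4 L, e ∈ l) ∧
      4 * C.card = 4 * Fintype.card (Site 4 L) ∧ C.card * (2 * (4 - 1)) = Fintype.card (Plaquette 4 L) ∧
      ∀ p : Plaquette 4 L, ∃ e ∈ ({(p.1, p.2.1.1), (p.1.shift p.2.1.1, p.2.1.2),
          (p.1.shift p.2.1.2, p.2.1.1), (p.1, p.2.1.2)} : Finset (Edge 4 L)),
        e ∈ C ∧ ∀ e' ∈ ({(p.1, p.2.1.1), (p.1.shift p.2.1.1, p.2.1.2),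
          (p.1.shift p.2.1.2, p.2.1.1), (p.1, p.2.1.2)} : Finset (Edge 4 L)), e' ≠ e → l.idxOf e' < l.idxOf e := by
  obtain ⟨C, hC⟩ := exists_plaquetteCover_four (L := L) (even_iff_two_dvd.1 hL)
  obtain ⟨l, h⟩ := exists_sharp_order_of_cover (by norm_num) (two_le_of_even hL) C hC
  exact ⟨l, C, h⟩

end Summit.Ventures.LatticeQCDFlow.Theory2.Autoregressive
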